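import Literature.IUT.HodgeTheaters.ConventionsCatIsomorphismGroup
import HarnessLib

/-!
# Kernel triviality of `Aut(𝒞) → Aut(𝒟)` is invariant under an equivalence OVER the base
# ([IUTchI] Cor 5.3 (ii), injectivity half: transport between carriers of the same place)

S. Mochizuki, *Inter-universal Teichmüller theory I*, kurims manuscript (May 2020), Corollary 5.3 (ii) p. 144
l. 14–18 («the natural map `Isom(¹𝔉, ²𝔉) → Isom(¹𝔇, ²𝔇)` [cf. Remark 5.2.1, (i)] is bijective»), proof l. 33–36 ([IUTchI] Cor 5.3 (ii) p.144)
[claim: Mochizuki2012, status: disputed] (D-0012 claim key; pure category theory below; nothing of the series is asserted,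
no side is taken on [IUTchIII] Cor. 3.12).  S. Mochizuki, *The geometry of Frobenioids I*, Kyushu J. Math. **62** (2008),
Def. 1.3 / Cor. 4.11 (iv) (a Frobenioid `𝒞 → 𝒟` over its base; 1-compatibility) [cite: MochizukiFrdI2008, Cor. 4.11(iv) p.92].

PROOF-ONLY file (cell abc-iut; seat abc-iut-L1-t7 gen 9; row «C53ii/S2c HMON-AT-REAL-CV», junction service for the L5 hub
base-merge).  abc-iut-L5-t4's `Cor53.cosetCat_descend_injective_of_kernel_trivial` consumes the kernel-triviality clause
  `hker : ∀ Ψ : 𝒞 ≌ 𝒞, Nonempty (LiesUnder p p Ψ (Equivalence.refl)) → Nonempty (Ψ.functor ≅ 𝟭 𝒞)`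
at the REAL carriers `GoodLocalFrobenioid.ofGalois …`, while abc-iut-L1-t7's `PadicFrd.Datum.hker_genuine` (p504140) proves it
at the `p`-adic Frobenioids over L1's genuine §2 base form.  The two carriers of one place are related by an equivalence of
Frobenioids lying over (the identity of) the common base `𝓑(Π_v)⁰`; this file records the purely 2-categorical fact that
`hker` TRANSPORTS along any such equivalence:
* `CatIsomorphism.kernelTrivial_of_equivalence_over` — if `F : 𝒞 ≌ 𝒞'` with `F ⋙ p' ≅ p` and `hker` holds for `(𝒞', p')`,
  then `hker` holds for `(𝒞, p)` (conjugate `Ψ` by `F`; unit/counit bookkeeping);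
* `CatIsomorphism.kernelTrivial_iff_of_equivalence_over` — hence `hker(𝒞, p) ↔ hker(𝒞', p')`.
No definition, instance, notation or `Prop` fact; classical 2-category bookkeeping (Mac Lane, *Categories for the Working
Mathematician*, IV.4). [folklore]
-/

namespace Literature.AlgebraicGeometry.Frobenioids

open CategoryTheory Literature.IUT.HodgeTheaters Literature.IUT.HodgeTheaters.CatIsomorphism

universe v₁ v₂ v₃ u₁ u₂ u₃

namespace CatIsomorphism

variable {C : Type u₁} [Category.{v₁} C] {C' : Type u₂} [Category.{v₂} C'] {D : Type u₃} [Category.{v₃} D]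
  (p : C ⥤ D) (p' : C' ⥤ D)

/-- **Kernel triviality transports along an equivalence over the base.**  Let `F : 𝒞 ≌ 𝒞'` lie over the identity of
`𝒟` (`hF : F ⋙ p' ≅ p`).  If every self-equivalence of `𝒞'` lying over `𝟭_𝒟` is `≅ 𝟭`, then so is every
self-equivalence of `𝒞` lying over `𝟭_𝒟`: for such `Ψ`, the conjugate `F⁻¹ ≫ Ψ ≫ F` lies over `𝟭_𝒟`, hence is `≅ 𝟭`,
and `Ψ ≅ F ≫ (F⁻¹ ≫ Ψ ≫ F) ≫ F⁻¹ ≅ 𝟭`. ([IUTchI] Cor 5.3 (ii) p.144) [claim: Mochizuki2012, status: disputed] -/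
theorem kernelTrivial_of_equivalence_over (F : C ≌ C') (hF : F.functor ⋙ p' ≅ p)
    (hker' : ∀ Ψ' : C' ≌ C',
      Nonempty (LiesUnder p' p' Ψ' (CategoryTheory.Equivalence.refl (C := D))) → Nonempty (Ψ'.functor ≅ 𝟭 C'))
    (Ψ : C ≌ C) (h : Nonempty (LiesUnder p p Ψ (CategoryTheory.Equivalence.refl (C := D)))) :
    Nonempty (Ψ.functor ≅ 𝟭 C) := by
  obtain ⟨h⟩ := h
  -- `h : Ψ ⋙ p ≅ p ⋙ 𝟭`
  have h₀ : Ψ.functor ⋙ p ≅ p := h ≪≫ p.rightUnitor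
  -- the conjugate `Ψ' := F⁻¹ ≫ Ψ ≫ F`, with functor `F.inverse ⋙ Ψ.functor ⋙ F.functor`
  let Ψ' : C' ≌ C' := F.symm.trans (Ψ.trans F)
  -- it lies over `𝟭_𝒟`
  have hinv : F.inverse ⋙ p ≅ p' :=
    Functor.isoWhiskerLeft F.inverse hF.symm ≪≫ (Functor.associator F.inverse F.functor p').symm ≪≫
      Functor.isoWhiskerRight F.counitIso p' ≪≫ p'.leftUnitor
  have h' : LiesUnder p' p' Ψ' (CategoryTheory.Equivalence.refl (C := D)) :=
    show (F.inverse ⋙ Ψ.functor ⋙ F.functor) ⋙ p' ≅ p' ⋙ 𝟭 D from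
      Functor.associator F.inverse (Ψ.functor ⋙ F.functor) p' ≪≫
        Functor.isoWhiskerLeft F.inverse (Functor.associator Ψ.functor F.functor p' ≪≫
          Functor.isoWhiskerLeft Ψ.functor hF ≪≫ h₀) ≪≫ hinv ≪≫ p'.rightUnitor.symm
  obtain ⟨i'⟩ := hker' Ψ' ⟨h'⟩
  -- `i' : F.inverse ⋙ Ψ.functor ⋙ F.functor ≅ 𝟭`; conjugate back
  have i'' : F.inverse ⋙ Ψ.functor ⋙ F.functor ≅ 𝟭 C' := i'
  refine ⟨?_⟩
  calc Ψ.functor ≅ 𝟭 C ⋙ Ψ.functor ⋙ 𝟭 C := (Functor.leftUnitor _).symm ≪≫ (Functor.rightUnitor _).symm ≪≫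
          Functor.associator _ _ _
    _ ≅ (F.functor ⋙ F.inverse) ⋙ Ψ.functor ⋙ (F.functor ⋙ F.inverse) :=
        Functor.isoWhiskerRight F.unitIso _ ≪≫ Functor.isoWhiskerLeft _ (Functor.isoWhiskerLeft _ F.unitIso)
    _ ≅ F.functor ⋙ (F.inverse ⋙ Ψ.functor ⋙ F.functor) ⋙ F.inverse :=
        Functor.associator _ _ _ ≪≫ Functor.isoWhiskerLeft F.functor
          ((Functor.associator _ _ _).symm ≪≫ (Functor.associator _ _ _).symm ≪≫
            Functor.isoWhiskerRight (Functor.associator _ _ _) _)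
    _ ≅ F.functor ⋙ 𝟭 C' ⋙ F.inverse := Functor.isoWhiskerLeft F.functor (Functor.isoWhiskerRight i'' F.inverse)
    _ ≅ F.functor ⋙ F.inverse := Functor.isoWhiskerLeft F.functor (Functor.leftUnitor _)
    _ ≅ 𝟭 C := F.unitIso.symm

/-- `hker` for `(𝒞, p)` iff `hker` for `(𝒞', p')`, for `F : 𝒞 ≌ 𝒞'` over the identity of the base.
([IUTchI] Cor 5.3 (ii) p.144) [claim: Mochizuki2012, status: disputed] -/
theorem kernelTrivial_iff_of_equivalence_over (F : C ≌ C') (hF : F.functor ⋙ p' ≅ p) :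
    (∀ Ψ : C ≌ C, Nonempty (LiesUnder p p Ψ (CategoryTheory.Equivalence.refl (C := D))) →
        Nonempty (Ψ.functor ≅ 𝟭 C)) ↔
      (∀ Ψ' : C' ≌ C', Nonempty (LiesUnder p' p' Ψ' (CategoryTheory.Equivalence.refl (C := D))) →
        Nonempty (Ψ'.functor ≅ 𝟭 C')) := by
  refine ⟨fun hker Ψ' h' => ?_, fun hker' Ψ h => kernelTrivial_of_equivalence_over p p' F hF hker' Ψ h⟩
  have hF' : F.inverse ⋙ p ≅ p' :=
    Functor.isoWhiskerLeft F.inverse hF.symm ≪≫ (Functor.associator F.inverse F.functor p').symm ≪≫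
      Functor.isoWhiskerRight F.counitIso p' ≪≫ p'.leftUnitor
  exact kernelTrivial_of_equivalence_over p' p F.symm hF' hker Ψ' h'

end CatIsomorphism

end Literature.AlgebraicGeometry.Frobenioids
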